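import Literature.MathematicalPhysics.QuantumFieldTheory.Balaban1983to89.T4PathVarianceRate

/-!
# RUNG (B)+1, NODE U5 (NE7), PROVER SEAT P3 (variance / second-moment route), GEN 10: THE HYBRID IN THE MEAN — NE7-HM:
# node U5's two-class input with the bad class, and every failure of the good-class sandwich, charged IN THE MEAN to each
# run's OWN law; its term-wise socket on single-run cores; the Z-level dictionary; and the converse NE7-HM ⟺ NE7-TV ∧ tilt
# (ADDITIVE SIBLING LEAF on `T4PathVarianceRate` v1.5 (this lineage, frozen with its consumers `T4ApexCanonical` §10.2 and
# `T4PathVarianceWeightSplit`; the 200 000 B leaf cap forbids a v1.6); no importer; cell `pub-balaban`, scoping sub-cell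
# `t4`, unit `b2b-balaban-t4-ne7-p3-g10`, journal row T4-U5.NE7-PROVE-P3*)

HONEST FRAMING.  Rung (B)+1 of the cell's ladder = the `ε → 0` limit of gauge-invariant unit-scale averaged loop
observables on ONE FIXED four-torus, a scoping target carried with (B) = [Balaban1989LargeFieldII] Thm 1 and the
β-function hypothesis `BetaPertH` as EXPLICIT hypotheses wherever they enter (they enter NO declaration of this file).
It is NOT the infinite-volume limit, NOT a mass gap, NOT the Clay problem, and nothing here is summit progress.  Every
declaration is [folklore]: tilted measures, indicator algebra, finite sums over the tree's own definitions; the analytic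
INPUT (a two-run comparison of consecutive effective unit-lattice laws) is a HYPOTHESIS SHAPE and is NOT PRINTED anywhere in
[B4]–[B16] ([Balaban1989LargeFieldII] p.356: «deserve detailed analysis and further publication»; the cell's referee file
T4-REF-U5 F2).  The wall of this node for this seat (GAPS G-ne7p3-7) is UNCHANGED by this file.

TRIGGER (dependency audit, gen 10).  Two journalled findings of the cell about `T4PathVarianceRate` §9's field-level hybrid
NE7-H (`EffTermHybrid`: node U5's carved two-class input asked of the term densities POINTWISE in the unit-lattice field).
(i) ne7b-p2-g13 LOCATE NOTE (journal l.58995): the located STABILITY input that floors a run's unit-lattice density from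
below is POINTWISE ONLY ON A SINGLE-RUN CORE — the support of that run's own characteristic functions intersected with its
printed action bound ((P1) `1 ≤ χ_K` there, (P2) the action bound); off the core print gives NO FIELD-UNIFORM FLOOR — on
`supp χ_K ∖ S_K` only the positive but field-DEPENDENT lower member of [B16] (0.1) / [B14] (2.50), off `supp χ_K` only
`ρ_K(u) ≥ 0` (the note's trichotomy (S)/(M)/(L), confirmed by ne7b-p2-g15, journal 2026-08-19T19:01:07Z; XREAD pv04-g24 D-1).
So a relative bad-class weight `Σ_{Bad} a_τ(u) ≤ W_K·Σ_T a_τ(u)` AT EVERY FIELD — NE7-H's `bad_left/right`, and the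
denominator of gen 9's field-pointwise `RelWeightBound` socket (§7) — is not reachable from the printed inputs off the
cores.  (ii) t4-ne7-p2, `T4PathVarianceWeightSplit` v1.4 §5 (5.3), p192288 (`not_hybridSandwich_of_disjoint_support`): at a
field of the final-level indicator shell the two runs' term densities have DISJOINT supports and NO hybrid sandwich with
`W_K < 1` exists there — at field level that shell is a feasibility obstruction, not a weight.

WHAT THIS LEAF ADDS (all sorry-free; numbers = sections below).
* §1 THE MEAN-DEFECT TILT LEMMA (`measureReal_le_tilted_add_of_meanDefect`): `μ` a probability law, `ν = μ.tilted f`, and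
  the two-sided sandwich holding only DEFECTIVELY — `e^{c−r}(1 − β) ≤ e^{f}`, `e^{f}(1 − β') ≤ e^{c+r}` everywhere, measurable
  defects `0 ≤ β, β' ≤ 1` with `∫ β dμ ≤ W`, `∫ β' dν ≤ W'` (means under the respective OWN laws) — give
  `μ(A) ≤ ν(A) + (2r + W + W')` for every measurable `A`: numerator `∫_A e^f dμ ≥ e^{c−r}(μ(A) − W)`, partition function
  `Z(1 − W') ≤ e^{c+r}`.  No per-field denominator, no `W < 1`, no range of `f`, constant one — the member's Markov/Chebyshev
  step in place of a supremum, LINEAR in the mean defects.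
* §2 THE SHAPE NE7-HM `EffMeanHybrid F r W W'` along a unit factorisation (tilt relation + defective sandwich at every field +
  the two mean bounds, per `K`) ⇒ pv01's NE7-TV `T4MaximalCoupling.EffTVRate F (2r + W + W')` (`effTVRate_of_effMeanHybrid`),
  hence BY NAME the apex (`hasContinuumLimit_of_effMeanHybrid`), the carved Z-level NE7
  `T4CauchySum.MatchingModConstants 1 l₀ (e^{2l₀}·2(2r_K + W_K + W'_K))` for every string and radius, `GenFunCauchy`, and the
  limiting effective LAW (`exists_limitLaw_of_effMeanHybrid`, from `T4EffectiveLawLimit.exists_limitLaw_of_effTVRate`);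
  NE7-S and NE7-H are its defect-free instances (`effMeanHybrid_of_effTiltSandwich`, `effMeanHybrid_of_effTermHybrid`).
* §3 THE TERM-WISE SOCKET `EffTermMeanHybrid F r W W'` ⇒ NE7-HM with the same rates (`effMeanHybrid_of_effTermMeanHybrid`):
  per `K`, term densities `a_τ, b_τ ≥ 0` (`τ ∈ T`, finite) with positive totals, a field-INDEPENDENT good class `Gd ⊆ T`,
  two measurable single-run CORES `Sa, Sb`; the LOWER term-wise sandwich `e^{c−r} a_τ(u) ≤ b_τ(u)` (`τ ∈ Gd`) asked only on
  run A's core, the UPPER `b_τ(u) ≤ e^{c+r} a_τ(u)` only on run B's core — node U5b at field level, each inequality where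
  finding (i) locates that run's own stability input —; and IN THE MEAN, each run under its own law,
  `∫ (Σ_{T∖Gd} a)/(Σ_T a) d(effLaw_K) + effLaw_K(Saᶜ) ≤ W_K`, the same for `b` under `effLaw_{K+1}` with `Sb`, `W'_K`
  (defects `β = 1 − 1_{Sa}·(Σ_{Gd} a)/(Σ_T a)`, `β' = 1 − 1_{Sb}·(Σ_{Gd} b)/(Σ_T b)`: `meanDefect_core`,
  `ratio_bounds_of_goodClass`).  What (i) and (ii) cost in this currency: a field off a run's core, or a field of a
  support-disjoint shell (outside both cores), is a defect of size ONE charged to that run's OWN law — a single-run mass,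
  bookable iff summable in `K`; nothing is infeasible and no pointwise denominator is ever formed.
* §4 THE Z-LEVEL DICTIONARY.  Under the density identification `effLaw_K = (∫ Σ_T a_τ dvol)⁻¹ · (Σ_T a_τ)·vol` and
  `A K 0 τ = ∫ a_τ dvol`, the MEAN field-level relative bad weight IS node U5c's Z-level relative bad weight at source zero:
  `integral_badFraction_le_of_relWeightBound` turns the run-A clause of the EXISTING `T4WeightBudget.RelWeightBound l₀ T A B
  Bad W` at `t = 0` into `∫ (Σ_{Bad} a)/(Σ_T a) d(effLaw_K) ≤ W_K` (`integral_div_normDensity`).  So the field-level upgrade of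
  the carved route (laws instead of loop expectations) needs node U5c ONLY THROUGH ITS EXISTING Z-LEVEL OUTPUT at zero
  source; what it needs at FIELD level is node U5b's good-class sandwich on single-run cores of summable complement mass.
  (v1.1, §4b: the run-B twin `integral_badFraction_le_of_relWeightBound_right` from the clause `bad_right K 0`, and the pair
  `integral_badFraction_le_of_relWeightBound_both` — both mean hypotheses of NE7-HMT with full cores from ONE `RelWeightBound`.)
* §5 NO HIDDEN STRENGTH.  Conversely a TV bound between a probability law and its tilt IS a mean-defect sandwich with
  `r = 0`, `W = W' = t` (`exists_meanDefect_of_tv`: `β = (1 − e^f/Z)₊`, `β' = (1 − Z/e^f)₊`, `c = log Z`; the two means are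
  the two one-sided TV deficits); at clause level summable NE7-HM ⟺ summable NE7-TV ∧ the tilt relation
  (`exists_effMeanHybrid_summable_iff`).  NE7-HM is therefore the WEAKEST law-level currency of the lineage — exactly
  pv01's, in the two-class READING that the carved producers address (NE7-TV ⇐ NE7-HM ⇐ `EffTermMeanHybrid` ⇐ {U5b on cores,
  U5c at Z-level, summable core complements}).  It re-expresses the wall; it is NOT an estimate and discharges nothing.
* §6 the canonical forms along `T4RunLadder.unitFactorisation D hM g₀` (`CanonicalEffMeanHybrid`; apex, carved NE7,
  `GenFunCauchy`, limiting law, by name through `T4CanonicalTiltRate` §6).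
* §7 THE EVERYWHERE FORM (gen 9, unit `b2b-balaban-t4-ne7-p3-g9`, folded for contrast): NE7-H from data over ANY label type
  (`effTermHybrid_of_indexed` — answer to pv09-g12's XREAD INFO I-2, journal l.58706); the field-POINTWISE socket — one
  instance of `RelWeightBound 0 …` PER FIELD + field-uniform good-class sandwich ⇒ NE7-H
  (`effTermHybrid_of_pointwise_relWeightBound`) — whose denominator-side contract finding (i) shows NOT print-reachable off
  the cores and whose feasibility presupposition finding (ii) makes explicit
  (`false_of_pointwise_relWeightBound_of_disjoint_support`).  §3 is the form that replaces it.

(A1) CAVEAT (referee audit C-t4r3-1 (A1), recorded in `T4VarianceMatching`'s header).  A unit-scale large-field mass is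
`K`-independent at fixed renormalised coupling, so a core complement containing ALL large fields of the unit lattice is NOT
summable: the cores of §3 may fail only on THIN sets (e.g. the shell between two runs' final thresholds), and the good-class
sandwich must then hold, with field-uniform `(c_K, r_K)`, at fields carrying large plaquettes seen identically by both runs.
Whether the inductive bounds of [B13]–[B16] deliver such cores and such a sandwich is node U5b's question at field level —
NOT PRINTED ([Balaban1989LargeFieldII] p.356; T4-REF-U5 F2); nothing below asserts it.

WHAT THIS FILE DOES NOT DO.  It does not prove NE7-HM, NE7-H, NE7-S, NE7-V or NE7-TV for Bałaban's data (NOT PRINTED; the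
node's wall); it does not touch infinite volume, uniqueness beyond the tree's `T4LimitLaw`, rotation invariance or a mass
gap; it asserts no constant of [B4]–[B16]; `BetaPertH`, (B), (B^μ) appear in no declaration; no existing module is modified.

References: [Balaban1989LargeFieldII] = [B16] T. Bałaban, CMP 122 (1989) 355–392, Thm 1 p.356 and the deferral sentence
p.356; [Balaban1988LargeFieldI] = [B15] T. Bałaban, CMP 122 (1989) 175–202 (unit-lattice densities (0.1)).  In-tree:
`T4PathVarianceRate` v1.5 §9 (`EffTermHybrid`, `EffTiltSandwich`, `fieldHybridRate`, `measureReal_tilted_eq_div`, §9.2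
canonical); `T4MaximalCoupling.EffTVRate` (pv01); `T4EffectiveLawLimit` §1–§2, §SchemeCarved; `T4CanonicalTiltRate` §6;
`T4HybridMatching.HybridSandwich`, `T4WeightBudget.RelWeightBound` (t4-ne7-p1 / pv14); `T4PathVarianceWeightSplit` §5
(t4-ne7-p2).
VERSIONS.  v1 = p193082 (commit d34663957cbf, gen 10).  v1.1 (gen 10, ADDITIVE + DOCFIX): + §4b (2 theorems); the XREAD of v1
(pv04-g24, 2026-08-19T18:49:53Z: CLEAN ∣ ABSOLUTE RULE 0 ∣ objections 0 ∣ DOCFIX 1 ∣ INFO 4; certificate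
`XREAD-T4PathMeanHybrid-v1.md` f5407faf40f93c22, GAPS C-pv04g24-3) folded as wording only: D-1 (header TRIGGER (i) and §7's
socket docstring, with ne7b-p2-g15's confirmed trichotomy), I-2 (§4 docstring), I-3 (§3 shape docstring); every v1 declaration's
signature and proof byte-identical.
-/

noncomputable section

open MeasureTheory

namespace Literature.MathematicalPhysics.QuantumFieldTheory.Balaban1983to89.T4PathMeanHybrid

open T4PathVarianceRate T4VarianceMatching Missing T4Continuum T4LimitLaw

/-! ### §1 The mean-defect tilt lemma (abstract probability) -/

section MeanHybridAbstract

variable {α : Type*} [MeasurableSpace α] {μ : Measure α}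

/-- `1 − e^{−2r} ≤ 2r`. [folklore] -/
theorem one_sub_exp_neg_two_mul_le (r : ℝ) : 1 - Real.exp (-(2 * r)) ≤ 2 * r := by
  have := Real.add_one_le_exp (-(2 * r))
  linarith

/-- **THE MEAN-DEFECT TILT LEMMA.**  Let `μ` be a probability measure, `ν = μ.tilted f` (`e^{f}` integrable), and suppose the
two-sided sandwich `e^{c−r} ≤ e^{f} ≤ e^{c+r}` holds only DEFECTIVELY: `e^{c−r}(1 − β) ≤ e^{f}` and `e^{f}(1 − β') ≤ e^{c+r}`
everywhere, with measurable defects `0 ≤ β, β' ≤ 1` whose MEANS are small under the respective OWN laws: `∫ β dμ ≤ W`,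
`∫ β' dν ≤ W'`.  Then `μ(A) ≤ ν(A) + (2r + W + W')` for every measurable set `A`.  (Numerator: `∫_A e^f dμ ≥ e^{c−r}(μ(A) − W)`;
partition function: `Z(1 − W') ≤ e^{c+r}` from `∫ e^f(1 − β') dμ ≤ e^{c+r}` and `∫ β' e^f dμ = Z ∫ β' dν ≤ Z W'`; hence
`ν(A) ≥ e^{−2r}(1 − W')(μ(A) − W)`.)  No lower bound on the defects' complements, no `W < 1`, no range of `f` is needed.
[folklore] -/
theorem measureReal_le_tilted_add_of_meanDefect [IsProbabilityMeasure μ] {f β β' : α → ℝ}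
    (hfi : Integrable (fun x => Real.exp (f x)) μ) (hβm : Measurable β) (hβ'm : Measurable β')
    (hβ : ∀ x, 0 ≤ β x ∧ β x ≤ 1) (hβ' : ∀ x, 0 ≤ β' x ∧ β' x ≤ 1) {c r W W' : ℝ} (hr : 0 ≤ r)
    (hlow : ∀ x, Real.exp (c - r) * (1 - β x) ≤ Real.exp (f x))
    (hup : ∀ x, Real.exp (f x) * (1 - β' x) ≤ Real.exp (c + r))
    (hW : ∫ x, β x ∂μ ≤ W) (hW' : ∫ x, β' x ∂(μ.tilted f) ≤ W') {A : Set α} (hA : MeasurableSet A) :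
    μ.real A ≤ (μ.tilted f).real A + (2 * r + W + W') := by
  set Z : ℝ := ∫ x, Real.exp (f x) ∂μ with hZdef
  have hZ : 0 < Z := integral_exp_pos hfi
  have hβi : Integrable β μ :=
    integrable_of_abs_le μ hβm (B := 1) fun x => by rw [abs_of_nonneg (hβ x).1]; exact (hβ x).2
  have hβ'ei : Integrable (fun x => β' x * Real.exp (f x)) μ :=
    hfi.bdd_mul hβ'm.aestronglyMeasurable
      (ae_of_all _ fun x => by rw [Real.norm_eq_abs, abs_of_nonneg (hβ' x).1]; exact (hβ' x).2)
  have hW0 : 0 ≤ W := le_trans (integral_nonneg fun x => (hβ x).1) hW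
  have hW'0 : 0 ≤ W' := le_trans (integral_nonneg fun x => (hβ' x).1) hW'
  have hμA1 : μ.real A ≤ 1 := measureReal_le_one
  have hνA : (μ.tilted f).real A = (∫ x in A, Real.exp (f x) ∂μ) / Z := measureReal_tilted_eq_div μ f hA
  have hνA0 : 0 ≤ (μ.tilted f).real A := measureReal_nonneg
  -- (1) numerator
  have hN : Real.exp (c - r) * (μ.real A - W) ≤ ∫ x in A, Real.exp (f x) ∂μ := by
    have h1 : ∫ x in A, Real.exp (c - r) * (1 - β x) ∂μ ≤ ∫ x in A, Real.exp (f x) ∂μ :=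
      setIntegral_mono (((integrable_const (1 : ℝ)).sub hβi).const_mul _).integrableOn hfi.integrableOn hlow
    have h2 : ∫ x in A, Real.exp (c - r) * (1 - β x) ∂μ = Real.exp (c - r) * (μ.real A - ∫ x in A, β x ∂μ) := by
      rw [integral_const_mul, integral_sub (integrable_const (1 : ℝ)).integrableOn hβi.integrableOn, setIntegral_const,
        smul_eq_mul, mul_one]
    have h3 : ∫ x in A, β x ∂μ ≤ W := (setIntegral_le_integral hβi (ae_of_all _ fun x => (hβ x).1)).trans hW
    rw [h2] at h1
    refine le_trans ?_ h1
    exact mul_le_mul_of_nonneg_left (by linarith) (Real.exp_pos _).le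
  -- (2) partition function
  have hZW : Z * (1 - W') ≤ Real.exp (c + r) := by
    have h1 : ∫ x, β' x ∂(μ.tilted f) = (∫ x, β' x * Real.exp (f x) ∂μ) / Z := by
      rw [integral_tilted]
      simp_rw [smul_eq_mul]
      rw [← integral_div]
      refine integral_congr_ae (ae_of_all _ fun x => ?_)
      simp only
      rw [← hZdef]
      ring
    have h2 : ∫ x, β' x * Real.exp (f x) ∂μ ≤ W' * Z := by
      rw [h1, div_le_iff₀ hZ] at hW'
      exact hW'
    have h3 : ∫ x, (Real.exp (f x) - β' x * Real.exp (f x)) ∂μ ≤ ∫ x, Real.exp (c + r) ∂μ :=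
      integral_mono (hfi.sub hβ'ei) (integrable_const _) fun x => by
        have := hup x
        simp only
        nlinarith
    rw [integral_sub hfi hβ'ei, integral_const, smul_eq_mul, probReal_univ, one_mul] at h3
    rw [← hZdef] at h3
    nlinarith
  -- (3) combine
  rw [hνA]
  by_cases hW'1 : 1 ≤ W'
  · have : 0 ≤ (∫ x in A, Real.exp (f x) ∂μ) / Z := by rw [← hνA]; exact hνA0
    linarith
  by_cases hAW : μ.real A ≤ W
  · have : 0 ≤ (∫ x in A, Real.exp (f x) ∂μ) / Z := by rw [← hνA]; exact hνA0
    linarith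
  push Not at hW'1 hAW
  set e : ℝ := Real.exp (-(2 * r)) with hedef
  have he0 : 0 < e := Real.exp_pos _
  have he1 : e ≤ 1 := by rw [hedef]; exact Real.exp_le_one_iff.mpr (by linarith)
  have he2 : 1 - e ≤ 2 * r := one_sub_exp_neg_two_mul_le r
  have hkey : e * (1 - W') * (μ.real A - W) ≤ (∫ x in A, Real.exp (f x) ∂μ) / Z := by
    rw [le_div_iff₀ hZ]
    have hce : e * Real.exp (c + r) = Real.exp (c - r) := by
      rw [hedef, ← Real.exp_add]; ring_nf
    calc e * (1 - W') * (μ.real A - W) * Z = e * (Z * (1 - W')) * (μ.real A - W) := by ring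
      _ ≤ e * Real.exp (c + r) * (μ.real A - W) :=
          mul_le_mul_of_nonneg_right (mul_le_mul_of_nonneg_left hZW he0.le) (by linarith)
      _ = Real.exp (c - r) * (μ.real A - W) := by rw [hce]
      _ ≤ ∫ x in A, Real.exp (f x) ∂μ := hN
  have hprod : 0 ≤ (1 - μ.real A) * (1 - e * (1 - W')) :=
    mul_nonneg (by linarith) (by nlinarith)
  nlinarith [mul_nonneg he0.le hW'0, mul_nonneg (mul_nonneg he0.le hW'0) hW0, mul_nonneg he0.le hW0]

/-- The same in `ℝ≥0∞`: `μ A ≤ (μ.tilted f) A + ENNReal.ofReal (2r + W + W')`. [folklore] -/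
theorem measure_le_tilted_add_of_meanDefect [IsProbabilityMeasure μ] {f β β' : α → ℝ}
    (hfi : Integrable (fun x => Real.exp (f x)) μ) (hβm : Measurable β) (hβ'm : Measurable β')
    (hβ : ∀ x, 0 ≤ β x ∧ β x ≤ 1) (hβ' : ∀ x, 0 ≤ β' x ∧ β' x ≤ 1) {c r W W' : ℝ} (hr : 0 ≤ r)
    (hlow : ∀ x, Real.exp (c - r) * (1 - β x) ≤ Real.exp (f x))
    (hup : ∀ x, Real.exp (f x) * (1 - β' x) ≤ Real.exp (c + r))
    (hW : ∫ x, β x ∂μ ≤ W) (hW' : ∫ x, β' x ∂(μ.tilted f) ≤ W') {A : Set α} (hA : MeasurableSet A) :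
    μ A ≤ μ.tilted f A + ENNReal.ofReal (2 * r + W + W') := by
  have h := measureReal_le_tilted_add_of_meanDefect hfi hβm hβ'm hβ hβ' hr hlow hup hW hW' hA
  have hW0 : 0 ≤ W := le_trans (integral_nonneg fun x => (hβ x).1) hW
  have hW'0 : 0 ≤ W' := le_trans (integral_nonneg fun x => (hβ' x).1) hW'
  haveI := isProbabilityMeasure_tilted hfi
  calc μ A = ENNReal.ofReal (μ.real A) := (ofReal_measureReal (measure_ne_top μ A)).symm
    _ ≤ ENNReal.ofReal ((μ.tilted f).real A + (2 * r + W + W')) := ENNReal.ofReal_le_ofReal h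
    _ = ENNReal.ofReal ((μ.tilted f).real A) + ENNReal.ofReal (2 * r + W + W') :=
        ENNReal.ofReal_add measureReal_nonneg (by positivity)
    _ = μ.tilted f A + ENNReal.ofReal (2 * r + W + W') := by
        rw [ofReal_measureReal (measure_ne_top (μ.tilted f) A)]

end MeanHybridAbstract

/-- **The pointwise sandwich is the defect-free case**: `|f − κ| ≤ r` everywhere gives the defective sandwich with
`β = β' = 0`. [folklore] -/
theorem meanDefect_of_abs_sub_le {α : Type*} {f : α → ℝ} {κ r : ℝ} (h : ∀ x, |f x - κ| ≤ r) (x : α) :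
    Real.exp (κ - r) * (1 - 0) ≤ Real.exp (f x) ∧ Real.exp (f x) * (1 - 0) ≤ Real.exp (κ + r) := by
  have h1 := (abs_le.mp (h x)).1
  have h2 := (abs_le.mp (h x)).2
  constructor
  · rw [sub_zero, mul_one]; exact Real.exp_le_exp.mpr (by linarith)
  · rw [sub_zero, mul_one]; exact Real.exp_le_exp.mpr (by linarith)


/-! ### §2 Scheme level: the shape NE7-HM and its consequences by name -/

/-- The rate produced by the mean hybrid: `2 r_K + W_K + W'_K` — LINEAR in the mean defects. [folklore] -/
def meanHybridRate (r W W' : ℕ → ℝ) (K : ℕ) : ℝ := 2 * r K + W K + W' K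

/-- The mean-hybrid rate is nonnegative when its three inputs are. [folklore] -/
theorem meanHybridRate_nonneg {r W W' : ℕ → ℝ} {K : ℕ} (hr : 0 ≤ r K) (hW : 0 ≤ W K) (hW' : 0 ≤ W' K) :
    0 ≤ meanHybridRate r W W' K := by unfold meanHybridRate; positivity

/-- The mean-hybrid rate is summable when its three inputs are. [folklore] -/
theorem summable_meanHybridRate {r W W' : ℕ → ℝ} (hr : Summable r) (hW : Summable W) (hW' : Summable W') :
    Summable (meanHybridRate r W W') :=
  ((hr.mul_left 2).add hW).add hW'

section MeanHybridScheme

variable {G : Type*} {O : Type*} {S : TorusScheme G O} [MeasurableSpace G] {X : Type*} [MeasurableSpace X]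
  (F : UnitFactorisation S X) [GaugeGroup G] [HaarData G] [RegularGaugeGroup G]

/-- **NE7-HM, THE FIELD-LEVEL HYBRID IN THE MEAN (hypothesis shape, NOT PRINTED).**  For every number of steps `K`: the
effective law of run `K+1` is the Gibbs tilt of that of run `K` by a measurable relative action `f_K`, and the two-run tilt
sandwich `e^{c_K − r_K} ≤ e^{f_K} ≤ e^{c_K + r_K}` holds only DEFECTIVELY — `e^{c−r}(1 − β_K(u)) ≤ e^{f_K(u)}` and
`e^{f_K(u)}(1 − β'_K(u)) ≤ e^{c+r}` at EVERY unit-lattice field `u` — with measurable defects `0 ≤ β_K, β'_K ≤ 1` whose MEANS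
under the runs' OWN effective laws are at most `W_K` resp. `W'_K`.  Compared with NE7-H (`EffTermHybrid`): the relative
bad-class weight is asked for IN THE MEAN under each run separately, not at every field; no `W_K < 1`; fields at which one
run's good class is empty (single-run cores violated, support-disjoint threshold shells) are defects of size one charged to
that run's own law.  SOURCE-FREE.  NOT PRINTED for Bałaban's data ([Balaban1989LargeFieldII] p. 356; T4-REF-U5 F2).
[folklore] -/
def EffMeanHybrid (r W W' : ℕ → ℝ) : Prop :=
  ∀ K, ∃ (f β β' : X → ℝ) (c : ℝ), Measurable f ∧ Measurable β ∧ Measurable β' ∧ 0 ≤ r K ∧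
    (∀ u, 0 ≤ β u ∧ β u ≤ 1) ∧ (∀ u, 0 ≤ β' u ∧ β' u ≤ 1) ∧
    (∀ u, Real.exp (c - r K) * (1 - β u) ≤ Real.exp (f u)) ∧
    (∀ u, Real.exp (f u) * (1 - β' u) ≤ Real.exp (c + r K)) ∧
    F.effLaw (K + 1) = (F.effLaw K).tilted f ∧
    ∫ u, β u ∂(F.effLaw K) ≤ W K ∧ ∫ u, β' u ∂(F.effLaw (K + 1)) ≤ W' K

omit [RegularGaugeGroup G] in
/-- The mean defects of an NE7-HM datum are nonnegative (and so is `r_K`). [folklore] -/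
theorem EffMeanHybrid.signBounds {r W W' : ℕ → ℝ} (h : EffMeanHybrid F r W W') (K : ℕ) :
    0 ≤ r K ∧ 0 ≤ W K ∧ 0 ≤ W' K := by
  obtain ⟨f, β, β', c, -, -, -, hr, hβb, hβ'b, -, -, -, hW, hW'⟩ := h K
  exact ⟨hr, le_trans (integral_nonneg fun u => (hβb u).1) hW, le_trans (integral_nonneg fun u => (hβ'b u).1) hW'⟩

/-- **NE7-HM ⇒ pv01's NE7-TV with the LINEAR rate `t_K = 2 r_K + W_K + W'_K`.** [folklore] -/
theorem effTVRate_of_effMeanHybrid (hβ : ∀ K, 0 ≤ S.β K) {r W W' : ℕ → ℝ} (h : EffMeanHybrid F r W W') :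
    T4MaximalCoupling.EffTVRate F (meanHybridRate r W W') := by
  intro K
  obtain ⟨f, β, β', c, hf, hβm, hβ'm, hr, hβb, hβ'b, hlow, hup, heq, hW, hW'⟩ := h K
  haveI := F.isProbabilityMeasure_effLaw hβ K
  have hK1 := F.isProbabilityMeasure_effLaw hβ (K + 1)
  have hfi : Integrable (fun u => Real.exp (f u)) (F.effLaw K) := by
    by_contra hni
    have h0 : F.effLaw (K + 1) = 0 := by rw [heq]; exact tilted_of_not_integrable hni
    have h1 := hK1.measure_univ
    rw [h0] at h1
    simp at h1
  have hW0 : 0 ≤ W K := le_trans (integral_nonneg fun u => (hβb u).1) hW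
  have hW'0 : 0 ≤ W' K := le_trans (integral_nonneg fun u => (hβ'b u).1) hW'
  refine ⟨meanHybridRate_nonneg hr hW0 hW'0, fun A hA => ?_⟩
  rw [heq] at hW' ⊢
  exact measure_le_tilted_add_of_meanDefect hfi hβm hβ'm hβb hβ'b hr hlow hup hW hW' hA

/-- **NE7-HM with `Σ r_K, Σ W_K, Σ W'_K < ∞` ⇒ THE APEX `HasContinuumLimit S`.** [folklore] -/
theorem hasContinuumLimit_of_effMeanHybrid (hβ : ∀ K, 0 ≤ S.β K) (hm : ∀ K o, Measurable (S.obs K o))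
    (h1 : ∀ K o U, |S.obs K o U| ≤ 1) {r W W' : ℕ → ℝ} (h : EffMeanHybrid F r W W') (hr : Summable r)
    (hW : Summable W) (hW' : Summable W') : HasContinuumLimit S :=
  T4MaximalCoupling.hasContinuumLimit_of_effTVRate F hβ hm h1 (summable_meanHybridRate hr hW hW')
    (effTVRate_of_effMeanHybrid F hβ h)

/-- **NE7-HM ⇒ THE CARVED (Z-level) NE7 for every string at every radius** (remainder `e^{2l₀}·2(2r_K + W_K + W'_K)`).
[folklore] -/
theorem matchingModConstants_of_effMeanHybrid (hβ : ∀ K, 0 ≤ S.β K) (hm : ∀ K o, Measurable (S.obs K o))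
    {r W W' : ℕ → ℝ} (h : EffMeanHybrid F r W W') {l₀ : ℝ} (hl₀ : 0 ≤ l₀) (os : List O) :
    T4CauchySum.MatchingModConstants 1 l₀ (fun K => Real.exp (2 * l₀) * (2 * meanHybridRate r W W' K))
      (T4GenFunBounds.schemeZ S os) :=
  T4EffectiveLawLimit.matchingModConstants_of_effTVRate F hβ hm (effTVRate_of_effMeanHybrid F hβ h) hl₀ os

/-- NE7-HM with summable rates ⇒ node U0's input `GenFunCauchy S l₀`, every `l₀ ≥ 0`. [folklore] -/
theorem genFunCauchy_of_effMeanHybrid (hβ : ∀ K, 0 ≤ S.β K) (hm : ∀ K o, Measurable (S.obs K o))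
    {r W W' : ℕ → ℝ} (h : EffMeanHybrid F r W W') (hr : Summable r) (hW : Summable W) (hW' : Summable W')
    {l₀ : ℝ} (hl₀ : 0 ≤ l₀) : T4Assembly.GenFunCauchy S l₀ :=
  T4EffectiveLawLimit.genFunCauchy_of_effTVRate F hβ hm (summable_meanHybridRate hr hW hW')
    (effTVRate_of_effMeanHybrid F hβ h) hl₀

/-- **NE7-HM with summable rates ⇒ THE LIMITING EFFECTIVE UNIT-LATTICE LAW** (TV convergence of all runs' effective laws,
tail rate `2 Σ_{j ≥ K}(2r_j + W_j + W'_j)`). [folklore] -/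
theorem exists_limitLaw_of_effMeanHybrid (hβ : ∀ K, 0 ≤ S.β K) {r W W' : ℕ → ℝ} (h : EffMeanHybrid F r W W')
    (hr : Summable r) (hW : Summable W) (hW' : Summable W') :
    ∃ ν : Measure X, IsProbabilityMeasure ν ∧ ν ≪ T4EffectiveLawLimit.domMeasure F.effLaw ∧
      ∀ (K : ℕ) (B : ℝ) (g : X → ℝ), Measurable g → (∀ u, |g u| ≤ B) →
        |∫ u, g u ∂(F.effLaw K) - ∫ u, g u ∂ν| ≤ B * ∑' j, 2 * meanHybridRate r W W' (j + K) :=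
  T4EffectiveLawLimit.exists_limitLaw_of_effTVRate F hβ (effTVRate_of_effMeanHybrid F hβ h)
    (summable_meanHybridRate hr hW hW')

omit [RegularGaugeGroup G] in
/-- **NE7-S ⇒ NE7-HM with no defects** (`β = β' = 0`, `W = W' = 0`). [folklore] -/
theorem effMeanHybrid_of_effTiltSandwich {r : ℕ → ℝ} (h : EffTiltSandwich F r) : EffMeanHybrid F r 0 0 := by
  intro K
  obtain ⟨f, κ, hf, hr, hb, heq⟩ := h K
  refine ⟨f, fun _ => 0, fun _ => 0, κ, hf, measurable_const, measurable_const, hr,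
    fun _ => ⟨le_rfl, zero_le_one⟩, fun _ => ⟨le_rfl, zero_le_one⟩,
    fun u => (meanDefect_of_abs_sub_le hb u).1, fun u => (meanDefect_of_abs_sub_le hb u).2, heq, ?_, ?_⟩
  · simp
  · simp

omit [RegularGaugeGroup G] in
/-- **NE7-H ⇒ NE7-HM** (through NE7-S: rate `r_K − log(1 − W_K)`, no defects). [folklore] -/
theorem effMeanHybrid_of_effTermHybrid {r W : ℕ → ℝ} (h : EffTermHybrid F r W) :
    EffMeanHybrid F (fieldHybridRate r W) 0 0 :=
  effMeanHybrid_of_effTiltSandwich F (effTiltSandwich_of_effTermHybrid h)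

end MeanHybridScheme

/-! ### §3 The term-wise socket: good class POINTWISE ON SINGLE-RUN CORES, bad class and core complements IN THE MEAN -/

section TermMeanAbstract

variable {α : Type*} [MeasurableSpace α] {μ : Measure α}

/-- **Core + fraction ⇒ defect.**  For a measurable `0 ≤ g ≤ 1` (a run's GOOD fraction) and a measurable core `S`, the defect
`β = 1 − 1_S·g` is measurable, lies in `[0,1]`, and its mean is at most the mean BAD fraction plus the run's OWN mass of the
core complement: `∫ β dμ ≤ ∫ (1 − g) dμ + μ(Sᶜ)`. [folklore] -/
theorem meanDefect_core [IsProbabilityMeasure μ] {g : α → ℝ} (hgm : Measurable g) (hg : ∀ x, 0 ≤ g x ∧ g x ≤ 1)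
    {S : Set α} (hS : MeasurableSet S) :
    Measurable (fun x => 1 - S.indicator g x) ∧ (∀ x, 0 ≤ 1 - S.indicator g x ∧ 1 - S.indicator g x ≤ 1) ∧
      ∫ x, (1 - S.indicator g x) ∂μ ≤ ∫ x, (1 - g x) ∂μ + μ.real Sᶜ := by
  have hgi : Integrable g μ :=
    integrable_of_abs_le μ hgm (B := 1) fun x => by rw [abs_of_nonneg (hg x).1]; exact (hg x).2
  have hind0 : ∀ x, 0 ≤ S.indicator g x := fun x => Set.indicator_nonneg (fun y _ => (hg y).1) x
  have hind1 : ∀ x, S.indicator g x ≤ 1 := fun x =>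
    Set.indicator_apply_le' (fun _ => (hg x).2) (fun _ => zero_le_one)
  refine ⟨measurable_const.sub (hgm.indicator hS), fun x => ⟨by linarith [hind1 x], by linarith [hind0 x]⟩, ?_⟩
  rw [integral_sub (integrable_const 1) (hgi.indicator hS), integral_sub (integrable_const 1) hgi,
    integral_indicator hS, integral_const, smul_eq_mul, mul_one, probReal_univ]
  have hsplit := integral_add_compl hS hgi
  have hle : ∫ x in Sᶜ, g x ∂μ ≤ μ.real Sᶜ := by
    have h1 := setIntegral_mono (s := Sᶜ) hgi.integrableOn (integrable_const (1 : ℝ)).integrableOn fun x => (hg x).2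
    rwa [setIntegral_const, smul_eq_mul, mul_one] at h1
  linarith

/-- **Two term families at one field: the defective sandwich from the good class.**  Nonnegative families `a, b` on a
finite label set `T` with positive totals, a good class `Gd ⊆ T`; the RATIO OF TOTALS `(Σ_T b)/(Σ_T a)` is bounded BELOW by
`e^{c−r}·(good fraction of run A)` when the lower term-wise sandwich holds on `Gd`, and `(Σ_T b)/(Σ_T a)·(good fraction of
run B) ≤ e^{c+r}` when the upper one holds. [folklore] -/
theorem ratio_bounds_of_goodClass {ι : Type*} [DecidableEq ι] {T Gd : Finset ι} {a b : ι → ℝ} {c r : ℝ} (hGd : Gd ⊆ T)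
    (ha : ∀ τ ∈ T, 0 ≤ a τ) (hb : ∀ τ ∈ T, 0 ≤ b τ) (hA : 0 < ∑ τ ∈ T, a τ) (hB : 0 < ∑ τ ∈ T, b τ) :
    ((∀ τ ∈ Gd, Real.exp (c - r) * a τ ≤ b τ) →
        Real.exp (c - r) * ((∑ τ ∈ Gd, a τ) / ∑ τ ∈ T, a τ) ≤ (∑ τ ∈ T, b τ) / ∑ τ ∈ T, a τ) ∧
    ((∀ τ ∈ Gd, b τ ≤ Real.exp (c + r) * a τ) →
        (∑ τ ∈ T, b τ) / (∑ τ ∈ T, a τ) * ((∑ τ ∈ Gd, b τ) / ∑ τ ∈ T, b τ) ≤ Real.exp (c + r)) := by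
  have hAg : ∑ τ ∈ Gd, a τ ≤ ∑ τ ∈ T, a τ :=
    Finset.sum_le_sum_of_subset_of_nonneg hGd fun τ hτ _ => ha τ hτ
  have hBg : ∑ τ ∈ Gd, b τ ≤ ∑ τ ∈ T, b τ :=
    Finset.sum_le_sum_of_subset_of_nonneg hGd fun τ hτ _ => hb τ hτ
  constructor
  · intro hlow
    have h1 : Real.exp (c - r) * ∑ τ ∈ Gd, a τ ≤ ∑ τ ∈ Gd, b τ := by
      rw [Finset.mul_sum]; exact Finset.sum_le_sum hlow
    rw [← mul_div_assoc, div_le_div_iff_of_pos_right hA]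
    exact h1.trans hBg
  · intro hup
    have h1 : ∑ τ ∈ Gd, b τ ≤ Real.exp (c + r) * ∑ τ ∈ Gd, a τ := by
      rw [Finset.mul_sum]; exact Finset.sum_le_sum hup
    have h2 : (∑ τ ∈ T, b τ) / (∑ τ ∈ T, a τ) * ((∑ τ ∈ Gd, b τ) / ∑ τ ∈ T, b τ) =
        (∑ τ ∈ Gd, b τ) / ∑ τ ∈ T, a τ := by
      field_simp
    rw [h2, div_le_iff₀ hA]
    exact h1.trans (mul_le_mul_of_nonneg_left hAg (Real.exp_pos _).le)

end TermMeanAbstract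

section TermMeanScheme

variable {G : Type*} {O : Type*} {S : TorusScheme G O} [MeasurableSpace G] {X : Type*} [MeasurableSpace X]
  (F : UnitFactorisation S X) [GaugeGroup G] [HaarData G] [RegularGaugeGroup G]

/-- **NE7-HMT, THE TERM-WISE SOCKET OF NE7-HM (hypothesis shape, NOT PRINTED).**  For every `K`: term labels `T`, a
(field-independent) good class `Gd ⊆ T`, the two runs' measurable nonnegative term DENSITIES `a τ, b τ` with positive totals,
a constant `c`, a number `0 ≤ r K`, and two measurable single-run CORES `Sa, Sb` of unit-lattice fields such that
(U5b at field level, on the cores only) the term-wise sandwich holds for the good class — its LOWER half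
`e^{c−r} a_τ(u) ≤ b_τ(u)` at the fields of run A's core `Sa`, its UPPER half `b_τ(u) ≤ e^{c+r} a_τ(u)` at the fields of run B's
core `Sb` —, the effective law of run `K+1` is the tilt of run `K`'s by `log Σ_T b − log Σ_T a`, and (U5c IN THE MEAN, each run
under ITS OWN law) the mean relative bad-class weight plus the own mass of the core complement is at most `W K` for run A,
`W' K` for run B.  Nothing is asked OFF a run's core about that run's comparison, no relative weight is asked at any single
field, no `W K < 1`.  HYGIENE (documented, XREAD pv04-g24 I-3): everywhere-positivity of BOTH totals together with the log-ratio
tilt presupposes mutually absolutely continuous consecutive effective laws; an instantiation from the FULL expansions must supply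
it (or modify the term densities on an `effLaw`-null set, to which `Measure.tilted` is insensitive).  NOT PRINTED for Bałaban's
data. [folklore] -/
def EffTermMeanHybrid (r W W' : ℕ → ℝ) : Prop :=
  ∀ K, ∃ (T Gd : Finset ℕ) (a b : ℕ → X → ℝ) (c : ℝ) (Sa Sb : Set X),
    Gd ⊆ T ∧ (∀ τ ∈ T, Measurable (a τ)) ∧ (∀ τ ∈ T, Measurable (b τ)) ∧ MeasurableSet Sa ∧ MeasurableSet Sb ∧
    0 ≤ r K ∧ (∀ u, ∀ τ ∈ T, 0 ≤ a τ u) ∧ (∀ u, ∀ τ ∈ T, 0 ≤ b τ u) ∧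
    (∀ u, 0 < ∑ τ ∈ T, a τ u) ∧ (∀ u, 0 < ∑ τ ∈ T, b τ u) ∧
    (∀ u ∈ Sa, ∀ τ ∈ Gd, Real.exp (c - r K) * a τ u ≤ b τ u) ∧
    (∀ u ∈ Sb, ∀ τ ∈ Gd, b τ u ≤ Real.exp (c + r K) * a τ u) ∧
    F.effLaw (K + 1) =
      (F.effLaw K).tilted (fun u => Real.log (∑ τ ∈ T, b τ u) - Real.log (∑ τ ∈ T, a τ u)) ∧
    ∫ u, (∑ τ ∈ T \ Gd, a τ u) / (∑ τ ∈ T, a τ u) ∂(F.effLaw K) + (F.effLaw K).real Saᶜ ≤ W K ∧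
    ∫ u, (∑ τ ∈ T \ Gd, b τ u) / (∑ τ ∈ T, b τ u) ∂(F.effLaw (K + 1)) + (F.effLaw (K + 1)).real Sbᶜ ≤ W' K

/-- **NE7-HMT ⇒ NE7-HM with the SAME `(r, W, W')`**: defects `β = 1 − 1_{Sa}·(Σ_{Gd} a)/(Σ_T a)`,
`β' = 1 − 1_{Sb}·(Σ_{Gd} b)/(Σ_T b)`. [folklore] -/
theorem effMeanHybrid_of_effTermMeanHybrid (hβ : ∀ K, 0 ≤ S.β K) {r W W' : ℕ → ℝ}
    (h : EffTermMeanHybrid F r W W') : EffMeanHybrid F r W W' := by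
  intro K
  obtain ⟨T, Gd, a, b, c, Sa, Sb, hGd, ham, hbm, hSa, hSb, hr, ha0, hb0, hA, hB, hlow, hup, heq, hW, hW'⟩ := h K
  haveI := F.isProbabilityMeasure_effLaw hβ K
  haveI := F.isProbabilityMeasure_effLaw hβ (K + 1)
  -- the two good fractions
  set gA : X → ℝ := fun u => (∑ τ ∈ Gd, a τ u) / ∑ τ ∈ T, a τ u with hgA
  set gB : X → ℝ := fun u => (∑ τ ∈ Gd, b τ u) / ∑ τ ∈ T, b τ u with hgB
  have hAm : Measurable fun u => ∑ τ ∈ T, a τ u := Finset.measurable_sum T ham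
  have hBm : Measurable fun u => ∑ τ ∈ T, b τ u := Finset.measurable_sum T hbm
  have hgAm : Measurable gA := (Finset.measurable_sum Gd fun τ hτ => ham τ (hGd hτ)).div hAm
  have hgBm : Measurable gB := (Finset.measurable_sum Gd fun τ hτ => hbm τ (hGd hτ)).div hBm
  have hgAb : ∀ u, 0 ≤ gA u ∧ gA u ≤ 1 := fun u =>
    ⟨div_nonneg (Finset.sum_nonneg fun τ hτ => ha0 u τ (hGd hτ)) (hA u).le,
      (div_le_one (hA u)).mpr (Finset.sum_le_sum_of_subset_of_nonneg hGd fun τ hτ _ => ha0 u τ hτ)⟩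
  have hgBb : ∀ u, 0 ≤ gB u ∧ gB u ≤ 1 := fun u =>
    ⟨div_nonneg (Finset.sum_nonneg fun τ hτ => hb0 u τ (hGd hτ)) (hB u).le,
      (div_le_one (hB u)).mpr (Finset.sum_le_sum_of_subset_of_nonneg hGd fun τ hτ _ => hb0 u τ hτ)⟩
  obtain ⟨hβm, hβb, hβI⟩ := meanDefect_core (μ := F.effLaw K) hgAm hgAb hSa
  obtain ⟨hβ'm, hβ'b, hβ'I⟩ := meanDefect_core (μ := F.effLaw (K + 1)) hgBm hgBb hSb
  -- bad fraction = 1 − good fraction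
  have hbadA : ∀ u, (∑ τ ∈ T \ Gd, a τ u) / (∑ τ ∈ T, a τ u) = 1 - gA u := fun u => by
    rw [hgA, eq_sub_iff_add_eq, ← add_div, Finset.sum_sdiff hGd, div_self (hA u).ne']
  have hbadB : ∀ u, (∑ τ ∈ T \ Gd, b τ u) / (∑ τ ∈ T, b τ u) = 1 - gB u := fun u => by
    rw [hgB, eq_sub_iff_add_eq, ← add_div, Finset.sum_sdiff hGd, div_self (hB u).ne']
  simp_rw [hbadA] at hW
  simp_rw [hbadB] at hW'
  -- the relative action is the log-ratio of totals
  have hexp : ∀ u, Real.exp (Real.log (∑ τ ∈ T, b τ u) - Real.log (∑ τ ∈ T, a τ u)) =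
      (∑ τ ∈ T, b τ u) / ∑ τ ∈ T, a τ u := fun u => by
    rw [Real.exp_sub, Real.exp_log (hB u), Real.exp_log (hA u)]
  refine ⟨fun u => Real.log (∑ τ ∈ T, b τ u) - Real.log (∑ τ ∈ T, a τ u), fun u => 1 - Sa.indicator gA u,
    fun u => 1 - Sb.indicator gB u, c, hBm.log.sub hAm.log, hβm, hβ'm, hr, hβb, hβ'b, fun u => ?_, fun u => ?_, heq,
    hβI.trans hW, hβ'I.trans hW'⟩
  · simp only [sub_sub_cancel, hexp]
    by_cases hu : u ∈ Sa
    · rw [Set.indicator_of_mem hu]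
      exact (ratio_bounds_of_goodClass hGd (ha0 u) (hb0 u) (hA u) (hB u)).1 (hlow u hu)
    · rw [Set.indicator_of_notMem hu, mul_zero]
      exact div_nonneg (hB u).le (hA u).le
  · simp only [sub_sub_cancel, hexp]
    by_cases hu : u ∈ Sb
    · rw [Set.indicator_of_mem hu]
      exact (ratio_bounds_of_goodClass hGd (ha0 u) (hb0 u) (hA u) (hB u)).2 (hup u hu)
    · rw [Set.indicator_of_notMem hu, mul_zero]
      exact (Real.exp_pos _).le

/-- NE7-HMT with `Σ r, Σ W, Σ W' < ∞` ⇒ the apex. [folklore] -/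
theorem hasContinuumLimit_of_effTermMeanHybrid (hβ : ∀ K, 0 ≤ S.β K) (hm : ∀ K o, Measurable (S.obs K o))
    (h1 : ∀ K o U, |S.obs K o U| ≤ 1) {r W W' : ℕ → ℝ} (h : EffTermMeanHybrid F r W W') (hr : Summable r)
    (hW : Summable W) (hW' : Summable W') : HasContinuumLimit S :=
  hasContinuumLimit_of_effMeanHybrid F hβ hm h1 (effMeanHybrid_of_effTermMeanHybrid F hβ h) hr hW hW'

/-! REMARK.  NE7-HMT tolerates fields at which the two families have DISJOINT supports — put them outside both cores, at the
price of their single-run masses —, where NE7-H's pointwise hybrid sandwich is infeasible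
(`T4PathVarianceWeightSplit.not_hybridSandwich_of_disjoint_support`, §7's
`false_of_pointwise_relWeightBound_of_disjoint_support`).  No comparison NE7-H ⇒ NE7-HMT is claimed (NE7-H's good class may
depend on the field); NE7-H ⇒ NE7-HM is `effMeanHybrid_of_effTermHybrid`. -/

end TermMeanScheme

/-! ### §4 The Z-level dictionary: the MEAN field-level bad fraction is node U5c's relative bad weight at source zero -/

section Dictionary

variable {α : Type*} [MeasurableSpace α]

/-- **Mean of a fraction under the normalised density law.**  If `μ = (∫A dvol)⁻¹ · A·vol` is the probability law with
measurable density `A > 0`, then for ANY `g`:  `∫ (g/A) dμ = (∫ g dvol)/(∫ A dvol)` (both sides are junk together when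
`A` is not integrable). [folklore] -/
theorem integral_div_normDensity (vol : Measure α) {A : α → ℝ} (g : α → ℝ) (hAm : Measurable A)
    (hA : ∀ x, 0 < A x) :
    ∫ x, g x / A x ∂((ENNReal.ofReal (∫ x, A x ∂vol))⁻¹ • vol.withDensity fun x => ENNReal.ofReal (A x)) =
      (∫ x, g x ∂vol) / ∫ x, A x ∂vol := by
  have hZ0 : 0 ≤ ∫ x, A x ∂vol := integral_nonneg fun x => (hA x).le
  rw [integral_smul_measure, ENNReal.toReal_inv, ENNReal.toReal_ofReal hZ0]
  have hden : (vol.withDensity fun x => ENNReal.ofReal (A x)) = vol.withDensity fun x => ((A x).toNNReal : ENNReal) := rfl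
  rw [hden, integral_withDensity_eq_integral_smul hAm.real_toNNReal]
  have hpt : (fun x => (A x).toNNReal • (g x / A x)) = g := by
    funext x
    rw [NNReal.smul_def, Real.coe_toNNReal _ (hA x).le, smul_eq_mul, mul_div_cancel₀ _ (hA x).ne']
  rw [hpt, smul_eq_mul, div_eq_inv_mul]

open T4WeightBudget (RelWeightBound)

/-- **THE HOOK TO NODE U5c's EXISTING OUTPUT.**  If run A's effective law at step `K` is the normalised density law of the
total `Σ_{T K} a_τ` of its term densities against a reference measure `vol` (positive total, integrable terms), and the
Z-level class weights at source zero ARE the integrated densities, `A K 0 τ = ∫ a_τ dvol`, then node U5c's carved output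
`T4WeightBudget.RelWeightBound l₀ T A B Bad W` (its run-A clause `bad_left`, and the typing clause `bad_subset`, at `t = 0`;
nothing else of the structure is consumed — XREAD pv04-g24 I-2) gives the MEAN field-level relative bad weight
`∫ (Σ_{Bad K 0} a_τ)/(Σ_{T K} a_τ) dμ_K ≤ W K` — the run-A mean hypothesis of NE7-HMT with `Gd = T K ∖ Bad K 0` and full core.
No pointwise-in-the-field weight bound is involved. [folklore] -/
theorem integral_badFraction_le_of_relWeightBound {ι : Type*} [DecidableEq ι] {l₀ : ℝ} (hl₀ : 0 ≤ l₀)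
    {T : ℕ → Finset ι} {A B : ℕ → ℝ → ι → ℝ} {Bad : ℕ → ℝ → Finset ι} {W : ℕ → ℝ}
    (hRW : RelWeightBound l₀ T A B Bad W) (K : ℕ) (vol : Measure α) {a : ι → α → ℝ}
    (ham : ∀ τ ∈ T K, Measurable (a τ)) (hpos : ∀ x, 0 < ∑ τ ∈ T K, a τ x)
    (hai : ∀ τ ∈ T K, Integrable (a τ) vol) (hZ : 0 < ∑ τ ∈ T K, ∫ x, a τ x ∂vol)
    (hAK : ∀ τ ∈ T K, A K 0 τ = ∫ x, a τ x ∂vol) :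
    ∫ x, (∑ τ ∈ Bad K 0, a τ x) / (∑ τ ∈ T K, a τ x)
        ∂((ENNReal.ofReal (∫ x, ∑ τ ∈ T K, a τ x ∂vol))⁻¹ •
          vol.withDensity fun x => ENNReal.ofReal (∑ τ ∈ T K, a τ x)) ≤ W K := by
  have hl : |(0 : ℝ)| ≤ l₀ := by rw [abs_zero]; exact hl₀
  have hBadT : Bad K 0 ⊆ T K := hRW.bad_subset K 0 hl
  rw [integral_div_normDensity vol _ (Finset.measurable_sum _ ham) hpos,
    integral_finsetSum _ hai, integral_finsetSum _ fun τ hτ => hai τ (hBadT hτ), div_le_iff₀ hZ]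
  have hb := hRW.bad_left K 0 hl
  rw [Finset.sum_congr rfl fun τ hτ => hAK τ (hBadT hτ), Finset.sum_congr rfl fun τ hτ => hAK τ hτ] at hb
  exact hb

end Dictionary

/-! #### §4b (v1.1, additive) The run-B twin of the Z-dictionary and the pair -/

section DictionaryB

variable {α : Type*} [MeasurableSpace α]

open T4WeightBudget (RelWeightBound)

/-- **THE HOOK TO NODE U5c's EXISTING OUTPUT, run B.**  Twin of `integral_badFraction_le_of_relWeightBound` for the run-B
clause `bad_right K 0` of `T4WeightBudget.RelWeightBound l₀ T A B Bad W`: if run B's effective law (the law at step `K+1` in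
NE7-HMT) is the normalised density law of `Σ_{T K} b_τ` and `B K 0 τ = ∫ b_τ dvol`, the MEAN field-level relative bad
weight of run B is at most `W K` — the run-B mean hypothesis of NE7-HMT with `Gd = T K ∖ Bad K 0` and full core. [folklore] -/
theorem integral_badFraction_le_of_relWeightBound_right {ι : Type*} [DecidableEq ι] {l₀ : ℝ} (hl₀ : 0 ≤ l₀)
    {T : ℕ → Finset ι} {A B : ℕ → ℝ → ι → ℝ} {Bad : ℕ → ℝ → Finset ι} {W : ℕ → ℝ}
    (hRW : RelWeightBound l₀ T A B Bad W) (K : ℕ) (vol : Measure α) {b : ι → α → ℝ}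
    (hbm : ∀ τ ∈ T K, Measurable (b τ)) (hpos : ∀ x, 0 < ∑ τ ∈ T K, b τ x)
    (hbi : ∀ τ ∈ T K, Integrable (b τ) vol) (hZ : 0 < ∑ τ ∈ T K, ∫ x, b τ x ∂vol)
    (hBK : ∀ τ ∈ T K, B K 0 τ = ∫ x, b τ x ∂vol) :
    ∫ x, (∑ τ ∈ Bad K 0, b τ x) / (∑ τ ∈ T K, b τ x)
        ∂((ENNReal.ofReal (∫ x, ∑ τ ∈ T K, b τ x ∂vol))⁻¹ •
          vol.withDensity fun x => ENNReal.ofReal (∑ τ ∈ T K, b τ x)) ≤ W K := by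
  have hl : |(0 : ℝ)| ≤ l₀ := by rw [abs_zero]; exact hl₀
  have hBadT : Bad K 0 ⊆ T K := hRW.bad_subset K 0 hl
  rw [integral_div_normDensity vol _ (Finset.measurable_sum _ hbm) hpos,
    integral_finsetSum _ hbi, integral_finsetSum _ fun τ hτ => hbi τ (hBadT hτ), div_le_iff₀ hZ]
  have hb := hRW.bad_right K 0 hl
  rw [Finset.sum_congr rfl fun τ hτ => hBK τ (hBadT hτ), Finset.sum_congr rfl fun τ hτ => hBK τ hτ] at hb
  exact hb

/-- **Both mean bad fractions at once** (the pair of mean hypotheses of NE7-HMT with full cores, from ONE `RelWeightBound` at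
source zero). [folklore] -/
theorem integral_badFraction_le_of_relWeightBound_both {ι : Type*} [DecidableEq ι] {l₀ : ℝ} (hl₀ : 0 ≤ l₀)
    {T : ℕ → Finset ι} {A B : ℕ → ℝ → ι → ℝ} {Bad : ℕ → ℝ → Finset ι} {W : ℕ → ℝ}
    (hRW : RelWeightBound l₀ T A B Bad W) (K : ℕ) (vol : Measure α) {a b : ι → α → ℝ}
    (ham : ∀ τ ∈ T K, Measurable (a τ)) (hbm : ∀ τ ∈ T K, Measurable (b τ))
    (hapos : ∀ x, 0 < ∑ τ ∈ T K, a τ x) (hbpos : ∀ x, 0 < ∑ τ ∈ T K, b τ x)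
    (hai : ∀ τ ∈ T K, Integrable (a τ) vol) (hbi : ∀ τ ∈ T K, Integrable (b τ) vol)
    (hZa : 0 < ∑ τ ∈ T K, ∫ x, a τ x ∂vol) (hZb : 0 < ∑ τ ∈ T K, ∫ x, b τ x ∂vol)
    (hAK : ∀ τ ∈ T K, A K 0 τ = ∫ x, a τ x ∂vol) (hBK : ∀ τ ∈ T K, B K 0 τ = ∫ x, b τ x ∂vol) :
    ∫ x, (∑ τ ∈ Bad K 0, a τ x) / (∑ τ ∈ T K, a τ x)
        ∂((ENNReal.ofReal (∫ x, ∑ τ ∈ T K, a τ x ∂vol))⁻¹ •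
          vol.withDensity fun x => ENNReal.ofReal (∑ τ ∈ T K, a τ x)) ≤ W K ∧
    ∫ x, (∑ τ ∈ Bad K 0, b τ x) / (∑ τ ∈ T K, b τ x)
        ∂((ENNReal.ofReal (∫ x, ∑ τ ∈ T K, b τ x ∂vol))⁻¹ •
          vol.withDensity fun x => ENNReal.ofReal (∑ τ ∈ T K, b τ x)) ≤ W K :=
  ⟨integral_badFraction_le_of_relWeightBound hl₀ hRW K vol ham hapos hai hZa hAK,
    integral_badFraction_le_of_relWeightBound_right hl₀ hRW K vol hbm hbpos hbi hZb hBK⟩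

end DictionaryB

/-! ### §5 No hidden strength: NE7-HM IS pv01's NE7-TV in two-class clothing (the converse) -/

section ConverseAbstract

variable {α : Type*} [MeasurableSpace α] {μ : Measure α}

/-- `1 − max 0 (1 − y) ≤ y`. [folklore] -/
theorem one_sub_max_zero_one_sub_le (y : ℝ) : 1 - max 0 (1 - y) ≤ y := by
  have := le_max_right 0 (1 - y)
  linarith

/-- **A TV BOUND BETWEEN A LAW AND ITS TILT IS A MEAN-DEFECT SANDWICH WITH `r = 0`, `W = W' = t`.**  For a probability law
`μ`, `e^{f}` integrable, `ν = μ.tilted f` and `μ(A) ≤ ν(A) + t` for all measurable `A`: with `Z = ∫ e^f dμ`, `c = log Z`,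
`β = (1 − e^f/Z)₊`, `β' = (1 − Z/e^f)₊` the defective sandwich `e^{c}(1 − β) ≤ e^f`, `e^f(1 − β') ≤ e^{c}` holds EVERYWHERE and
`∫ β dμ = μ(D) − ν(D) ≤ t` (`D = {e^f ≤ Z}`), `∫ β' dν = ν(E) − μ(E) = μ(Eᶜ) − ν(Eᶜ) ≤ t` (`E = {Z ≤ e^f}`).  So the mean
hybrid has NO content beyond total variation plus the (qualitative) tilt relation. [folklore] -/
theorem exists_meanDefect_of_tv [IsProbabilityMeasure μ] {f : α → ℝ} (hf : Measurable f)
    (hfi : Integrable (fun x => Real.exp (f x)) μ) {t : ℝ}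
    (htv : ∀ A, MeasurableSet A → μ.real A ≤ (μ.tilted f).real A + t) :
    ∃ (β β' : α → ℝ) (c : ℝ), Measurable β ∧ Measurable β' ∧ (∀ x, 0 ≤ β x ∧ β x ≤ 1) ∧ (∀ x, 0 ≤ β' x ∧ β' x ≤ 1) ∧
      (∀ x, Real.exp c * (1 - β x) ≤ Real.exp (f x)) ∧ (∀ x, Real.exp (f x) * (1 - β' x) ≤ Real.exp c) ∧
      ∫ x, β x ∂μ ≤ t ∧ ∫ x, β' x ∂(μ.tilted f) ≤ t := by
  set Z : ℝ := ∫ x, Real.exp (f x) ∂μ with hZdef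
  have hZ : 0 < Z := integral_exp_pos hfi
  haveI := isProbabilityMeasure_tilted hfi
  set g : α → ℝ := fun x => Real.exp (f x) / Z with hgdef
  have hgm : Measurable g := (Real.measurable_exp.comp hf).div_const Z
  have hg0 : ∀ x, 0 < g x := fun x => div_pos (Real.exp_pos _) hZ
  have hgZ : ∀ x, Z * g x = Real.exp (f x) := fun x => by rw [hgdef]; field_simp
  -- the two defects
  set D : Set α := {x | g x ≤ 1} with hDdef
  set E : Set α := {x | 1 ≤ g x} with hEdef
  have hD : MeasurableSet D := measurableSet_le hgm measurable_const
  have hE : MeasurableSet E := measurableSet_le measurable_const hgm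
  have hβD : (fun x => max 0 (1 - g x)) = D.indicator fun x => 1 - g x := by
    funext x
    by_cases hx : x ∈ D
    · rw [Set.indicator_of_mem hx]; exact max_eq_right (by simpa [hDdef] using hx)
    · rw [Set.indicator_of_notMem hx]
      have hx' : 1 < g x := lt_of_not_ge (by simpa [hDdef] using hx)
      exact max_eq_left (by linarith)
  have hβ'E : (fun x => max 0 (1 - (g x)⁻¹)) = E.indicator fun x => 1 - (g x)⁻¹ := by
    funext x
    by_cases hx : x ∈ E
    · rw [Set.indicator_of_mem hx]
      have hx' : 1 ≤ g x := by simpa [hEdef] using hx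
      exact max_eq_right (by rw [sub_nonneg]; exact inv_le_one_of_one_le₀ hx')
    · rw [Set.indicator_of_notMem hx]
      have hx' : g x < 1 := lt_of_not_ge (by simpa [hEdef] using hx)
      have : 1 < (g x)⁻¹ := (one_lt_inv₀ (hg0 x)).mpr hx'
      exact max_eq_left (by linarith)
  have hgi : Integrable g μ := hfi.div_const Z
  have hginv_bdd : ∀ x ∈ E, (g x)⁻¹ ≤ 1 := fun x hx => inv_le_one_of_one_le₀ (by simpa [hEdef] using hx)
  refine ⟨fun x => max 0 (1 - g x), fun x => max 0 (1 - (g x)⁻¹), Real.log Z,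
    measurable_const.max (measurable_const.sub hgm), measurable_const.max (measurable_const.sub hgm.inv),
    fun x => ⟨le_max_left _ _, max_le zero_le_one (by linarith [hg0 x])⟩,
    fun x => ⟨le_max_left _ _, max_le zero_le_one (by linarith [inv_pos.mpr (hg0 x)])⟩,
    fun x => ?_, fun x => ?_, ?_, ?_⟩
  · -- lower: Z (1 − β) ≤ Z g = e^f
    rw [Real.exp_log hZ, ← hgZ x]
    exact mul_le_mul_of_nonneg_left (one_sub_max_zero_one_sub_le (g x)) hZ.le
  · -- upper: e^f (1 − β') ≤ e^f g⁻¹ = Z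
    rw [Real.exp_log hZ]
    calc Real.exp (f x) * (1 - max 0 (1 - (g x)⁻¹)) ≤ Real.exp (f x) * (g x)⁻¹ :=
          mul_le_mul_of_nonneg_left (one_sub_max_zero_one_sub_le _) (Real.exp_pos _).le
      _ = Z := by rw [← hgZ x, mul_assoc, mul_inv_cancel₀ (hg0 x).ne', mul_one]
  · -- ∫ β dμ = μ(D) − ν(D) ≤ t
    rw [hβD, integral_indicator hD, integral_sub (integrable_const 1).integrableOn hgi.integrableOn, setIntegral_const,
      smul_eq_mul, mul_one]
    have hνD : (μ.tilted f).real D = ∫ x in D, g x ∂μ := by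
      rw [measureReal_tilted_eq_div μ f hD, hgdef, integral_div]
    linarith [htv D hD]
  · -- ∫ β' dν = ν(E) − μ(E) = μ(Eᶜ) − ν(Eᶜ) ≤ t
    have hgiE : IntegrableOn (fun x => (g x)⁻¹) E (μ.tilted f) := by
      refine (integrableOn_const (C := (1 : ℝ))).mono' hgm.inv.aestronglyMeasurable ?_
      exact (ae_restrict_iff' hE).mpr (ae_of_all _ fun x hx => by
        rw [Real.norm_eq_abs, abs_of_pos (inv_pos.mpr (hg0 x))]; exact hginv_bdd x hx)
    rw [hβ'E, integral_indicator hE, integral_sub (integrable_const 1).integrableOn hgiE, setIntegral_const,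
      smul_eq_mul, mul_one, setIntegral_tilted' f _ hE]
    have hone : ∫ x in E, (Real.exp (f x) / ∫ y, Real.exp (f y) ∂μ) • (g x)⁻¹ ∂μ = μ.real E := by
      have hpt : (fun x => (Real.exp (f x) / ∫ y, Real.exp (f y) ∂μ) • (g x)⁻¹) = fun _ => (1 : ℝ) := by
        funext x
        rw [smul_eq_mul, ← hZdef, show Real.exp (f x) / Z = g x from rfl, mul_inv_cancel₀ (hg0 x).ne']
      rw [hpt, setIntegral_const, smul_eq_mul, mul_one]
    rw [hone]
    have h1 := htv Eᶜ hE.compl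
    rw [measureReal_compl hE, measureReal_compl hE, probReal_univ, probReal_univ] at h1
    linarith

end ConverseAbstract

section ConverseScheme

variable {G : Type*} {O : Type*} {S : TorusScheme G O} [MeasurableSpace G] {X : Type*} [MeasurableSpace X]
  (F : UnitFactorisation S X) [GaugeGroup G] [HaarData G] [RegularGaugeGroup G]

/-- **NE7-TV + the tilt relation ⇒ NE7-HM with `r = 0`, `W = W' = t`.**  Together with `effTVRate_of_effMeanHybrid`
(rate `2r + W + W'`): at clause level the mean hybrid IS pv01's TV currency restricted to mutually absolutely continuous
consecutive laws — it adds no estimate, only the two-class READING of a TV bound. [folklore] -/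
theorem effMeanHybrid_of_effTVRate (hβ : ∀ K, 0 ≤ S.β K) {t : ℕ → ℝ} (ht : T4MaximalCoupling.EffTVRate F t)
    (htilt : ∀ K, ∃ f : X → ℝ, Measurable f ∧ F.effLaw (K + 1) = (F.effLaw K).tilted f) :
    EffMeanHybrid F 0 t t := by
  intro K
  obtain ⟨f, hf, heq⟩ := htilt K
  obtain ⟨ht0, hA⟩ := ht K
  haveI := F.isProbabilityMeasure_effLaw hβ K
  have hK1 := F.isProbabilityMeasure_effLaw hβ (K + 1)
  have hfi : Integrable (fun u => Real.exp (f u)) (F.effLaw K) := by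
    by_contra hni
    have h0 : F.effLaw (K + 1) = 0 := by rw [heq]; exact tilted_of_not_integrable hni
    have h1 := hK1.measure_univ
    rw [h0] at h1
    simp at h1
  haveI := isProbabilityMeasure_tilted hfi
  have htv : ∀ A, MeasurableSet A → (F.effLaw K).real A ≤ ((F.effLaw K).tilted f).real A + t K := by
    intro A hAm
    have h := hA A hAm
    rw [heq] at h
    have h' := ENNReal.toReal_mono (by finiteness) h
    rwa [ENNReal.toReal_add (measure_ne_top _ _) ENNReal.ofReal_ne_top, ENNReal.toReal_ofReal ht0] at h'
  obtain ⟨β, β', c, hβm, hβ'm, hβb, hβ'b, hlow, hup, hW, hW'⟩ := exists_meanDefect_of_tv hf hfi htv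
  refine ⟨f, β, β', c, hf, hβm, hβ'm, le_rfl, hβb, hβ'b, fun u => ?_, fun u => ?_, heq, hW, ?_⟩
  · simpa only [Pi.zero_apply, sub_zero] using hlow u
  · simpa only [Pi.zero_apply, add_zero] using hup u
  · rw [heq]; exact hW'

/-- **CLAUSE-LEVEL EQUIVALENCE: summable NE7-HM ⟺ summable NE7-TV ∧ the tilt relation.** [folklore] -/
theorem exists_effMeanHybrid_summable_iff (hβ : ∀ K, 0 ≤ S.β K) :
    (∃ r W W' : ℕ → ℝ, EffMeanHybrid F r W W' ∧ Summable r ∧ Summable W ∧ Summable W') ↔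
      (∃ t : ℕ → ℝ, T4MaximalCoupling.EffTVRate F t ∧ Summable t) ∧
        ∀ K, ∃ f : X → ℝ, Measurable f ∧ F.effLaw (K + 1) = (F.effLaw K).tilted f := by
  constructor
  · rintro ⟨r, W, W', h, hr, hW, hW'⟩
    refine ⟨⟨meanHybridRate r W W', effTVRate_of_effMeanHybrid F hβ h, summable_meanHybridRate hr hW hW'⟩, fun K => ?_⟩
    obtain ⟨f, -, -, -, hf, -, -, -, -, -, -, -, heq, -⟩ := h K
    exact ⟨f, hf, heq⟩
  · rintro ⟨⟨t, ht, hts⟩, htilt⟩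
    exact ⟨0, t, t, effMeanHybrid_of_effTVRate F hβ ht htilt, summable_zero, hts, hts⟩

end ConverseScheme

/-! ### §6 Along the canonical unit factorisation: the apex, the carved NE7 and the limiting law — by name -/

section CanonicalMeanHybrid

open T4Continuum T4RunLadder T4CanonicalTiltRate

variable {𝓕 : T4Family} {G : Type*} [GaugeGroup G] [MeasurableSpace G] [HaarData G] [RegularGaugeGroup G]

/-- **Canonical NE7-HM (hypothesis shape, NOT PRINTED)**: the field-level hybrid in the mean along the data's own unit
factorisation `T4RunLadder.unitFactorisation D hM g₀`.  With `Σ r, Σ W, Σ W' < ∞` it is — by §5 — EXACTLY the summable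
canonical NE7-TV together with the tilt relation: the weakest law-level form of the wall of node U5 for this seat
(GAPS G-ne7p3-7), NOT discharged here. [folklore] -/
def CanonicalEffMeanHybrid (D : FiniteEpsData 𝓕 G) (hM : D.AvgMeasurable) (g₀ : ℕ → ℝ) (r W W' : ℕ → ℝ) : Prop :=
  EffMeanHybrid (unitFactorisation D hM g₀) r W W'

/-- Canonical NE7-HM ⇒ canonical NE7-TV with `t = 2r + W + W'`. [folklore] -/
theorem canonicalEffTVRate_of_canonicalEffMeanHybrid (D : FiniteEpsData 𝓕 G) (hM : D.AvgMeasurable) (g₀ : ℕ → ℝ)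
    {r W W' : ℕ → ℝ} (h : CanonicalEffMeanHybrid D hM g₀ r W W') :
    T4MaximalCoupling.EffTVRate (unitFactorisation D hM g₀) (meanHybridRate r W W') :=
  effTVRate_of_effMeanHybrid _ (scheme_β_nonneg D g₀) h

/-- **Canonical NE7-HM with `Σ r, Σ W, Σ W' < ∞` ⇒ THE APEX `HasContinuumLimit (D.scheme g₀)`.** [folklore] -/
theorem hasContinuumLimit_of_canonicalEffMeanHybrid (D : FiniteEpsData 𝓕 G) (hM : D.AvgMeasurable) (g₀ : ℕ → ℝ)
    {r W W' : ℕ → ℝ} (h : CanonicalEffMeanHybrid D hM g₀ r W W') (hr : Summable r) (hW : Summable W)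
    (hW' : Summable W') : HasContinuumLimit (D.scheme g₀) :=
  hasContinuumLimit_of_effMeanHybrid _ (scheme_β_nonneg D g₀) (scheme_obs_measurable D hM g₀)
    (scheme_abs_obs_le_one D g₀) h hr hW hW'

/-- **Canonical NE7-HM ⇒ THE CARVED (Z-level) NE7 for EVERY string at EVERY radius `l₀ ≥ 0`** (remainder
`e^{2l₀}·2(2r_K + W_K + W'_K)`). [folklore] -/
theorem matchingModConstants_of_canonicalEffMeanHybrid (D : FiniteEpsData 𝓕 G) (hM : D.AvgMeasurable)
    (g₀ : ℕ → ℝ) {r W W' : ℕ → ℝ} (h : CanonicalEffMeanHybrid D hM g₀ r W W') {l₀ : ℝ} (hl₀ : 0 ≤ l₀)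
    (Cs : List (ULoop 𝓕)) :
    T4CauchySum.MatchingModConstants 1 l₀ (fun K => Real.exp (2 * l₀) * (2 * meanHybridRate r W W' K))
      (T4GenFunBounds.schemeZ (D.scheme g₀) Cs) :=
  matchingModConstants_of_canonicalEffTVRate D hM g₀ (canonicalEffTVRate_of_canonicalEffMeanHybrid D hM g₀ h) hl₀ Cs

/-- Canonical NE7-HM with summable rates ⇒ node U0's input `GenFunCauchy (D.scheme g₀) l₀`, every `l₀ ≥ 0`. [folklore] -/
theorem genFunCauchy_of_canonicalEffMeanHybrid (D : FiniteEpsData 𝓕 G) (hM : D.AvgMeasurable) (g₀ : ℕ → ℝ)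
    {r W W' : ℕ → ℝ} (h : CanonicalEffMeanHybrid D hM g₀ r W W') (hr : Summable r) (hW : Summable W)
    (hW' : Summable W') {l₀ : ℝ} (hl₀ : 0 ≤ l₀) : T4Assembly.GenFunCauchy (D.scheme g₀) l₀ :=
  genFunCauchy_of_canonicalEffTVRate D hM g₀ (summable_meanHybridRate hr hW hW')
    (canonicalEffTVRate_of_canonicalEffMeanHybrid D hM g₀ h) hl₀

/-- **Canonical NE7-HM with summable rates ⇒ THE LIMITING EFFECTIVE UNIT-LATTICE LAW OF THE DATA** (TV convergence of the
effective laws of all runs, tail rate `2 Σ_{j ≥ K}(2r_j + W_j + W'_j)`). [folklore] -/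
theorem exists_limitLaw_of_canonicalEffMeanHybrid (D : FiniteEpsData 𝓕 G) (hM : D.AvgMeasurable) (g₀ : ℕ → ℝ)
    {r W W' : ℕ → ℝ} (h : CanonicalEffMeanHybrid D hM g₀ r W W') (hr : Summable r) (hW : Summable W)
    (hW' : Summable W') :
    ∃ ν : Measure (GaugeField (𝓕.P 0) 0 G), IsProbabilityMeasure ν ∧
      ν ≪ T4EffectiveLawLimit.domMeasure (unitFactorisation D hM g₀).effLaw ∧
      ∀ (K : ℕ) (B : ℝ) (g : GaugeField (𝓕.P 0) 0 G → ℝ), Measurable g → (∀ u, |g u| ≤ B) →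
        |∫ u, g u ∂((unitFactorisation D hM g₀).effLaw K) - ∫ u, g u ∂ν| ≤ B * ∑' j, 2 * meanHybridRate r W W' (j + K) :=
  exists_limitLaw_of_canonicalEffTVRate D hM g₀ (canonicalEffTVRate_of_canonicalEffMeanHybrid D hM g₀ h)
    (summable_meanHybridRate hr hW hW')

/-- Canonical NE7-H ⇒ canonical NE7-HM (no defects, rate `r_K − log(1 − W_K)`). [folklore] -/
theorem canonicalEffMeanHybrid_of_canonicalEffTermHybrid (D : FiniteEpsData 𝓕 G) (hM : D.AvgMeasurable)
    (g₀ : ℕ → ℝ) {r W : ℕ → ℝ} (h : CanonicalEffTermHybrid D hM g₀ r W) :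
    CanonicalEffMeanHybrid D hM g₀ (fieldHybridRate r W) 0 0 :=
  effMeanHybrid_of_effTermHybrid _ h

/-- **The term-wise socket along the canonical factorisation ⇒ THE APEX**: good class pointwise on single-run cores, bad
class and core complements in the mean, `Σ r, Σ W, Σ W' < ∞`. [folklore] -/
theorem hasContinuumLimit_of_canonical_effTermMeanHybrid (D : FiniteEpsData 𝓕 G) (hM : D.AvgMeasurable) (g₀ : ℕ → ℝ)
    {r W W' : ℕ → ℝ} (h : EffTermMeanHybrid (unitFactorisation D hM g₀) r W W') (hr : Summable r) (hW : Summable W)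
    (hW' : Summable W') : HasContinuumLimit (D.scheme g₀) :=
  hasContinuumLimit_of_canonicalEffMeanHybrid D hM g₀
    (effMeanHybrid_of_effTermMeanHybrid _ (scheme_β_nonneg D g₀) h) hr hW hW'

end CanonicalMeanHybrid

/-! ### §7 The everywhere form (gen 9, folded): relabeling, the field-pointwise socket and its presupposition -/

section Relabel

open T4HybridMatching (HybridSandwich)

variable {G : Type*} {O : Type*} {S : TorusScheme G O} [MeasurableSpace G] {X : Type*} [MeasurableSpace X]
  {F : UnitFactorisation S X} [GaugeGroup G] [HaarData G]

omit [MeasurableSpace G] [GaugeGroup G] [HaarData G] in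
/-- Singleton fibres of a map injective on a finite set. [folklore] -/
theorem filter_eq_singleton_of_injOn {ι : Type*} [DecidableEq ι] {T : Finset ι} {e : ι → ℕ}
    (he : Set.InjOn e ↑T) {τ₀ : ι} (h₀ : τ₀ ∈ T) : T.filter (fun τ => e τ = e τ₀) = {τ₀} := by
  ext τ
  simp only [Finset.mem_filter, Finset.mem_singleton]
  constructor
  · rintro ⟨hτ, hε⟩
    exact he hτ h₀ hε
  · rintro rfl
    exact ⟨h₀, rfl⟩

/-- **NE7-H FROM DATA INDEXED BY ANY LABEL TYPE** (answer, in the kernel, to XREAD INFO I-2 of pv09-g12, journal l.58706: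
`EffTermHybrid` fixes its term labels in `ℕ` while `T4HybridMatching.HybridSandwich` / `T4WeightBudget.RelWeightBound` are
over an abstract index type).  The same clauses over `T : Finset ι`, `Gd : X → Finset ι`, `a b : ι → X → ℝ` give
`EffTermHybrid F r W`: relabel along an injection `e : ι → ℕ` on `T` (`Set.countable_iff_exists_injOn`), transporting the
densities as fibre sums (singletons on `T`), the good class as the image, and every clause by `Finset.sum_image` /
`Finset.sum_fiberwise_of_maps_to` / `Finset.image_sdiff_of_injOn`.  No hypothesis added or dropped. [folklore] -/
theorem effTermHybrid_of_indexed {ι : Type*} [DecidableEq ι] {r W : ℕ → ℝ}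
    (h : ∀ K, ∃ (T : Finset ι) (Gd : X → Finset ι) (a b : ι → X → ℝ) (c : ℝ),
      (∀ τ ∈ T, Measurable (a τ)) ∧ (∀ τ ∈ T, Measurable (b τ)) ∧ 0 ≤ r K ∧ 0 ≤ W K ∧ W K < 1 ∧
      (∀ u, 0 < ∑ τ ∈ T, a τ u) ∧
      (∀ u, HybridSandwich T (Gd u) (fun τ => a τ u) (fun τ => b τ u) c (r K) (W K)) ∧
      F.effLaw (K + 1) = (F.effLaw K).tilted fun u => Real.log (∑ τ ∈ T, b τ u) - Real.log (∑ τ ∈ T, a τ u)) :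
    EffTermHybrid F r W := by
  classical
  intro K
  obtain ⟨T, Gd, a, b, c, ha, hb, hr, hW0, hW1, hpos, hS, heq⟩ := h K
  obtain ⟨e, he⟩ := Set.countable_iff_exists_injOn.mp T.finite_toSet.countable
  -- transported densities: fibre sums (the fibres over `T` are singletons)
  let a' : ℕ → X → ℝ := fun n u => ∑ τ ∈ T.filter (fun τ => e τ = n), a τ u
  let b' : ℕ → X → ℝ := fun n u => ∑ τ ∈ T.filter (fun τ => e τ = n), b τ u
  have ha' : ∀ τ₀ ∈ T, ∀ u, a' (e τ₀) u = a τ₀ u := fun τ₀ h₀ u => by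
    simp only [a', filter_eq_singleton_of_injOn he h₀, Finset.sum_singleton]
  have hb' : ∀ τ₀ ∈ T, ∀ u, b' (e τ₀) u = b τ₀ u := fun τ₀ h₀ u => by
    simp only [b', filter_eq_singleton_of_injOn he h₀, Finset.sum_singleton]
  have hmaps : ∀ τ ∈ T, e τ ∈ T.image e := fun τ hτ => Finset.mem_image_of_mem e hτ
  have hsuma : ∀ u, ∑ n ∈ T.image e, a' n u = ∑ τ ∈ T, a τ u := fun u =>
    Finset.sum_fiberwise_of_maps_to hmaps fun τ => a τ u
  have hsumb : ∀ u, ∑ n ∈ T.image e, b' n u = ∑ τ ∈ T, b τ u := fun u =>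
    Finset.sum_fiberwise_of_maps_to hmaps fun τ => b τ u
  -- sums over the image of a subclass `C ⊆ T`
  have himg : ∀ (C : Finset ι), C ⊆ T → ∀ (f : ι → X → ℝ) (f' : ℕ → X → ℝ),
      (∀ τ₀ ∈ T, ∀ u, f' (e τ₀) u = f τ₀ u) → ∀ u, ∑ n ∈ C.image e, f' n u = ∑ τ ∈ C, f τ u := by
    intro C hC f f' hf u
    rw [Finset.sum_image (he.mono (by exact_mod_cast hC))]
    exact Finset.sum_congr rfl fun τ hτ => hf τ (hC hτ) u
  refine ⟨T.image e, fun u => (Gd u).image e, a', b', c, ?_, ?_, hr, hW0, hW1, ?_, fun u => ?_, ?_⟩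
  · intro n _
    exact Finset.measurable_sum _ fun τ hτ => ha τ (Finset.mem_filter.mp hτ).1
  · intro n _
    exact Finset.measurable_sum _ fun τ hτ => hb τ (Finset.mem_filter.mp hτ).1
  · intro u
    rw [hsuma u]
    exact hpos u
  · have hGT : Gd u ⊆ T := (hS u).subset
    have hsd : T.image e \ (Gd u).image e = (T \ Gd u).image e :=
      (Finset.image_sdiff_of_injOn he hGT).symm
    exact
      { subset := Finset.image_subset_image hGT
        nonneg_left := fun n _ =>
          Finset.sum_nonneg fun τ hτ => (hS u).nonneg_left τ (Finset.mem_filter.mp hτ).1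
        nonneg_right := fun n _ =>
          Finset.sum_nonneg fun τ hτ => (hS u).nonneg_right τ (Finset.mem_filter.mp hτ).1
        lower := by
          intro n hn
          obtain ⟨τ₀, h₀, rfl⟩ := Finset.mem_image.mp hn
          rw [ha' τ₀ (hGT h₀) u, hb' τ₀ (hGT h₀) u]
          exact (hS u).lower τ₀ h₀
        upper := by
          intro n hn
          obtain ⟨τ₀, h₀, rfl⟩ := Finset.mem_image.mp hn
          rw [ha' τ₀ (hGT h₀) u, hb' τ₀ (hGT h₀) u]
          exact (hS u).upper τ₀ h₀
        bad_left := by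
          rw [hsd, himg (T \ Gd u) Finset.sdiff_subset a a' ha' u, hsuma u]
          exact (hS u).bad_left
        bad_right := by
          rw [hsd, himg (T \ Gd u) Finset.sdiff_subset b b' hb' u, hsumb u]
          exact (hS u).bad_right }
  · have hfun : (fun u => Real.log (∑ n ∈ T.image e, b' n u) - Real.log (∑ n ∈ T.image e, a' n u)) =
        fun u => Real.log (∑ τ ∈ T, b τ u) - Real.log (∑ τ ∈ T, a τ u) := by
      funext u
      rw [hsuma u, hsumb u]
    rw [hfun]
    exact heq

end Relabel

section FieldPlug

open T4HybridMatching (HybridSandwich)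
open T4WeightBudget (RelWeightBound)

variable {G : Type*} {O : Type*} {S : TorusScheme G O} [MeasurableSpace G] {X : Type*} [MeasurableSpace X]
  {F : UnitFactorisation S X} [GaugeGroup G] [HaarData G]

/-- **THE EVERYWHERE SOCKET (gen 9): field-pointwise relative bad weight (owner's shape `RelWeightBound`, one instance PER
unit-lattice field, source-free) + field-uniform good-class sandwich + tilt identity ⇒ NE7-H `EffTermHybrid F r W`.**  The
good class is `T K ∖ Bad K` at every field.  CONTRACT NOT PRINT-REACHABLE on the denominator side (ne7b-p2-g13 LOCATE NOTE,
journal l.58995: a run's density is floored from below UNIFORMLY only on its single-run core; off the core print gives only a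
field-dependent lower member — positive on `supp χ_K ∖ S_K`, zero-compatible off `supp χ_K` —, hence no field-uniform
denominator; v1.1 wording after XREAD D-1 / ne7b-p2-g15) and
INFEASIBLE at support-disjoint fields (`false_of_pointwise_relWeightBound_of_disjoint_support`); kept as the everywhere
benchmark that §3's core/mean socket `effMeanHybrid_of_effTermMeanHybrid` replaces. [folklore] -/
theorem effTermHybrid_of_pointwise_relWeightBound [Nonempty X] {ι : Type*} [DecidableEq ι]
    {T Bad : ℕ → Finset ι} {a b : ℕ → ι → X → ℝ} {c r W : ℕ → ℝ}
    (ha : ∀ K, ∀ τ ∈ T K, Measurable (a K τ)) (hb : ∀ K, ∀ τ ∈ T K, Measurable (b K τ))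
    (hr : ∀ K, 0 ≤ r K)
    (ha0 : ∀ K u, ∀ τ ∈ T K, 0 ≤ a K τ u) (hb0 : ∀ K u, ∀ τ ∈ T K, 0 ≤ b K τ u)
    (hpos : ∀ K u, 0 < ∑ τ ∈ T K, a K τ u)
    (hW : ∀ u, RelWeightBound 0 T (fun K _ τ => a K τ u) (fun K _ τ => b K τ u) (fun K _ => Bad K) W)
    (hgood : ∀ K u, ∀ τ ∈ T K \ Bad K,
      Real.exp (c K - r K) * a K τ u ≤ b K τ u ∧ b K τ u ≤ Real.exp (c K + r K) * a K τ u)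
    (heq : ∀ K, F.effLaw (K + 1) =
      (F.effLaw K).tilted fun u => Real.log (∑ τ ∈ T K, b K τ u) - Real.log (∑ τ ∈ T K, a K τ u)) :
    EffTermHybrid F r W := by
  obtain ⟨u₀⟩ := ‹Nonempty X›
  have h0 : |(0 : ℝ)| ≤ 0 := by simp
  refine effTermHybrid_of_indexed fun K => ⟨T K, fun _ => T K \ Bad K, a K, b K, c K, ha K, hb K, hr K,
    (hW u₀).nonneg K, (hW u₀).lt_one K, hpos K, fun u => ?_, heq K⟩
  have hsd : T K \ (T K \ Bad K) = Bad K := Finset.sdiff_sdiff_eq_self ((hW u).bad_subset K 0 h0)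
  exact
    { subset := Finset.sdiff_subset
      nonneg_left := ha0 K u
      nonneg_right := hb0 K u
      lower := fun τ hτ => (hgood K u τ hτ).1
      upper := fun τ hτ => (hgood K u τ hτ).2
      bad_left := by rw [hsd]; exact (hW u).bad_left K 0 h0
      bad_right := by rw [hsd]; exact (hW u).bad_right K 0 h0 }

omit [MeasurableSpace G] [MeasurableSpace X] [GaugeGroup G] [HaarData G] in
/-- `Summable W` is carried by any one field's instance. [folklore] -/
theorem summable_of_pointwise_relWeightBound [Nonempty X] {ι : Type*} {T Bad : ℕ → Finset ι} {a b : ℕ → ι → X → ℝ}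
    {W : ℕ → ℝ}
    (hW : ∀ u, RelWeightBound 0 T (fun K _ τ => a K τ u) (fun K _ τ => b K τ u) (fun K _ => Bad K) W) :
    Summable W :=
  (hW (Classical.arbitrary X)).summable

omit [MeasurableSpace G] [MeasurableSpace X] [GaugeGroup G] [HaarData G] in
/-- **Feasibility presupposition of the socket** (owner's remark after t4-ne7-p2's `T4PathVarianceWeightSplit` v1.4 §5 (5.3),
p192288; cf. `T4PathVarianceWeightSplit.not_hybridSandwich_of_disjoint_support`).  The socket's hypotheses EXCLUDE
support-disjoint fields: if at ONE field `u₀` of positive run-A mass no good term `τ ∈ T K ∖ Bad K` is charged by both runs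
(`0 < a K τ u₀ → b K τ u₀ ≤ 0`), then the field-uniform good-class sandwich and the field-pointwise relative weight bound
(`W K < 1`, `Bad K` independent of the field) cannot both hold.  Hence a term-wise producer feeding this socket from
expansions cut with SHARP final-level characteristic functions at two different thresholds must carry final-level-MERGED
labels (node U5d; design (ii′)) or (η)-smoothed thresholds — the DICTIONARY of `T4PathVarianceWeightSplit` §5.  A remark on
the INSTANTIATION, not on the shape `EffTermHybrid` (which is existential in `(T, Gd, a, b, c)`: `effTermHybrid_zero_iff`).
[folklore] -/
theorem false_of_pointwise_relWeightBound_of_disjoint_support {ι : Type*} [DecidableEq ι] {T Bad : ℕ → Finset ι}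
    {a b : ℕ → ι → X → ℝ} {c r W : ℕ → ℝ}
    (ha0 : ∀ K u, ∀ τ ∈ T K, 0 ≤ a K τ u)
    (hW : ∀ u, RelWeightBound 0 T (fun K _ τ => a K τ u) (fun K _ τ => b K τ u) (fun K _ => Bad K) W)
    (hgood : ∀ K u, ∀ τ ∈ T K \ Bad K,
      Real.exp (c K - r K) * a K τ u ≤ b K τ u ∧ b K τ u ≤ Real.exp (c K + r K) * a K τ u)
    {K : ℕ} {u₀ : X} (hpos : 0 < ∑ τ ∈ T K, a K τ u₀)
    (hdis : ∀ τ ∈ T K \ Bad K, 0 < a K τ u₀ → b K τ u₀ ≤ 0) : False := by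
  classical
  have h0 : |(0 : ℝ)| ≤ 0 := by simp
  -- every good term of run A vanishes at `u₀`
  have hgood0 : ∀ τ ∈ T K \ Bad K, a K τ u₀ = 0 := by
    intro τ hτ
    have hτT : τ ∈ T K := (Finset.mem_sdiff.mp hτ).1
    rcases (ha0 K u₀ τ hτT).eq_or_lt with h | h
    · exact h.symm
    · exfalso
      have hb : b K τ u₀ ≤ 0 := hdis τ hτ h
      have hl := (hgood K u₀ τ hτ).1
      have hp : 0 < Real.exp (c K - r K) * a K τ u₀ := mul_pos (Real.exp_pos _) h
      linarith
  -- hence the whole run-A mass at `u₀` sits in the bad class …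
  have hsub : Bad K ⊆ T K := (hW u₀).bad_subset K 0 h0
  have hsplit : ∑ τ ∈ T K, a K τ u₀ = ∑ τ ∈ Bad K, a K τ u₀ := by
    rw [← Finset.sum_sdiff hsub, Finset.sum_eq_zero hgood0, zero_add]
  -- … whose relative weight is at most `W K < 1`: contradiction
  have hbad : ∑ τ ∈ Bad K, a K τ u₀ ≤ W K * ∑ τ ∈ T K, a K τ u₀ := (hW u₀).bad_left K 0 h0
  have hlt : W K * ∑ τ ∈ T K, a K τ u₀ < 1 * ∑ τ ∈ T K, a K τ u₀ :=
    mul_lt_mul_of_pos_right ((hW u₀).lt_one K) hpos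
  rw [one_mul, ← hsplit] at *
  linarith

end FieldPlug

section CanonicalFieldPlug

open T4Continuum T4RunLadder T4CanonicalTiltRate
open T4WeightBudget (RelWeightBound)

variable {𝓕 : T4Family} {G : Type*} [GaugeGroup G] [MeasurableSpace G] [HaarData G] [RegularGaugeGroup G]

/-- **Canonical form**: along `T4RunLadder.unitFactorisation D hM g₀` (unit-lattice field space `GaugeField (𝓕.P 0) 0 G`,
inhabited), field-pointwise `RelWeightBound` + field-uniform good-class sandwich + tilt identity ⇒ `CanonicalEffTermHybrid
D hM g₀ r W ∧ Summable W`; with `Summable r` this is an instance of the wall G-ne7p3-7 in its `T4PathVarianceRate` §9 typing, whence §9.2 there by name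
(`hasContinuumLimit_of_canonicalEffTermHybrid`, `matchingModConstants_of_…`, `exists_limitLaw_of_…`). NOT PRINTED. [folklore] -/
theorem canonicalEffTermHybrid_of_pointwise_relWeightBound (D : FiniteEpsData 𝓕 G) (hM : D.AvgMeasurable) (g₀ : ℕ → ℝ)
    {ι : Type*} [DecidableEq ι] {T Bad : ℕ → Finset ι} {a b : ℕ → ι → GaugeField (𝓕.P 0) 0 G → ℝ} {c r W : ℕ → ℝ}
    (ha : ∀ K, ∀ τ ∈ T K, Measurable (a K τ)) (hb : ∀ K, ∀ τ ∈ T K, Measurable (b K τ))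
    (hr : ∀ K, 0 ≤ r K)
    (ha0 : ∀ K u, ∀ τ ∈ T K, 0 ≤ a K τ u) (hb0 : ∀ K u, ∀ τ ∈ T K, 0 ≤ b K τ u)
    (hpos : ∀ K u, 0 < ∑ τ ∈ T K, a K τ u)
    (hW : ∀ u, RelWeightBound 0 T (fun K _ τ => a K τ u) (fun K _ τ => b K τ u) (fun K _ => Bad K) W)
    (hgood : ∀ K u, ∀ τ ∈ T K \ Bad K,
      Real.exp (c K - r K) * a K τ u ≤ b K τ u ∧ b K τ u ≤ Real.exp (c K + r K) * a K τ u)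
    (heq : ∀ K, (unitFactorisation D hM g₀).effLaw (K + 1) =
      ((unitFactorisation D hM g₀).effLaw K).tilted
        fun u => Real.log (∑ τ ∈ T K, b K τ u) - Real.log (∑ τ ∈ T K, a K τ u)) :
    CanonicalEffTermHybrid D hM g₀ r W ∧ Summable W :=
  ⟨effTermHybrid_of_pointwise_relWeightBound ha hb hr ha0 hb0 hpos hW hgood heq,
    summable_of_pointwise_relWeightBound hW⟩

/-- Hence the apex along the canonical factorisation, by name (`T4PathVarianceRate` §9.2). [folklore] -/
theorem hasContinuumLimit_of_pointwise_relWeightBound (D : FiniteEpsData 𝓕 G) (hM : D.AvgMeasurable) (g₀ : ℕ → ℝ)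
    {ι : Type*} [DecidableEq ι] {T Bad : ℕ → Finset ι} {a b : ℕ → ι → GaugeField (𝓕.P 0) 0 G → ℝ} {c r W : ℕ → ℝ}
    (ha : ∀ K, ∀ τ ∈ T K, Measurable (a K τ)) (hb : ∀ K, ∀ τ ∈ T K, Measurable (b K τ))
    (hr : ∀ K, 0 ≤ r K) (hrs : Summable r)
    (ha0 : ∀ K u, ∀ τ ∈ T K, 0 ≤ a K τ u) (hb0 : ∀ K u, ∀ τ ∈ T K, 0 ≤ b K τ u)
    (hpos : ∀ K u, 0 < ∑ τ ∈ T K, a K τ u)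
    (hW : ∀ u, RelWeightBound 0 T (fun K _ τ => a K τ u) (fun K _ τ => b K τ u) (fun K _ => Bad K) W)
    (hgood : ∀ K u, ∀ τ ∈ T K \ Bad K,
      Real.exp (c K - r K) * a K τ u ≤ b K τ u ∧ b K τ u ≤ Real.exp (c K + r K) * a K τ u)
    (heq : ∀ K, (unitFactorisation D hM g₀).effLaw (K + 1) =
      ((unitFactorisation D hM g₀).effLaw K).tilted
        fun u => Real.log (∑ τ ∈ T K, b K τ u) - Real.log (∑ τ ∈ T K, a K τ u)) :
    HasContinuumLimit (D.scheme g₀) :=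
  have h := canonicalEffTermHybrid_of_pointwise_relWeightBound D hM g₀ ha hb hr ha0 hb0 hpos hW hgood heq
  hasContinuumLimit_of_canonicalEffTermHybrid D hM g₀ h.1 hrs h.2

end CanonicalFieldPlug

end Literature.MathematicalPhysics.QuantumFieldTheory.Balaban1983to89.T4PathMeanHybrid
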